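import Literature.Probability.LatticeModels.LatticeBootstrapFeasible
import Literature.Probability.LatticeModels.IsingBoundaryMonotonicity
import Literature.Probability.LatticeModels.CriticalCorrWellDefined
import Literature.Probability.LatticeModels.PlusStateFKG
import Literature.Probability.LatticeModels.PlusFreeComparison
import Literature.Probability.LatticeModels.MessagerMiracleSole
import HarnessLib

/-!
# Uniform-in-boundary-condition convergence of box correlations and boundary-law mixtures

Theorem-only file. Nearest-neighbour Ising model on `ℤ^d`, zero field, `β ≥ 0`, `m*(β) = 0`:
* `isingCorr_fixed_box_sub_plusCorr_uniform`: `sup_η |⟨σ_A⟩^η_{B(L);β,0} - ⟨σ_A⟩⁺_{β,0}| → 0`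
  (`L → ∞`): box correlations converge to the plus state uniformly in the boundary condition;
* `boundaryLawFunctional_sub_plusCorr_uniform`: the same for the level-`L` boundary-law mixtures
  `∫ ⟨σ_A⟩^η_{B(L);β,0} ν(dη)` (`boundaryLawFunctional`), uniformly in the probability law `ν`;
* `boundaryLawFunctional_criticalBeta_pair_sub_criticalTwoPoint_uniform`: `d = 3`, `β = β_c(3)`
  (where `m*(β_c) = 0`, Aizenman–Duminil-Copin–Sidoravicius 2015, Thm. 1.2): every level-`L`
  mixture on a pair `{0, x}` is `ε`-close to `criticalTwoPoint 3 x` for `L ≥ L₀(ε)`, all `ν`.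

Paper proof (FKG sandwich): `σ_A = ∑_{B⊆A} c_B n_B` with `n_B = ∏_{i∈B} (1+σ_i)/2` increasing
(Friedli–Velenik 2017, Lemma 3.19); monotonicity in the boundary condition (Lemma 3.23,
Exercise 3.13) gives `⟨n_B⟩⁻_{B(L)} ≤ ⟨n_B⟩^η_{B(L)} ≤ ⟨n_B⟩⁺_{B(L)}`, hence the `η`-free bound
`|⟨σ_A⟩^η_{B(L)} - ⟨σ_A⟩⁺_{B(L)}| ≤ ∑_B |c_B| (⟨n_B⟩⁺_{B(L)} - ⟨n_B⟩⁻_{B(L)})`; for `m*(β) = 0` the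
`±` box states have equal limits (Thm. 3.28, Remark 3.30: uniqueness, equivalent to uniform-in-`η`
convergence of the kernels, cf. Lemma 6.30 and Georgii 2011, Prop. 7.11), so the bound tends to
`0`, while `⟨σ_A⟩⁺_{B(L)} → ⟨σ_A⟩⁺` (Thm. 3.17). Integrating over `η` gives the mixture version.

## References
* S. Friedli, Y. Velenik, *Statistical Mechanics of Lattice Systems* (CUP 2017), Lemma 3.19,
  Lemma 3.23, Exercise 3.13, Thm. 3.17, Thm. 3.28 / Remark 3.30, Lemma 6.30.
* H.-O. Georgii, *Gibbs Measures and Phase Transitions*, 2nd ed. (de Gruyter 2011), Prop. 7.11.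
* M. Aizenman, H. Duminil-Copin, V. Sidoravicius, Comm. Math. Phys. 334 (2015) 719–742, Thm. 1.2.
-/

noncomputable section

open MeasureTheory Filter Topology Finset

namespace Literature.Probability.LatticeModels

/-! ### The FKG sandwich in the boundary condition (general graphs) -/

section Sandwich

variable {V : Type*} (G : SimpleGraph V) [DecidableEq V] [G.LocallyFinite]

/-- **Linear decomposition of correlations into increasing indicators** (Friedli–Velenik 2017,
Lemma 3.19, integrated): `⟨σ_A⟩^{bc}_{Λ;β,h} = ∑_{B ⊆ A} (-1)^{|A∖B|} 2^{|B|} ⟨n_B⟩^{bc}_{Λ;β,h}`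
with `n_B = ∏_{i ∈ B} (1 + σ_i)/2`. [cite: FriedliVelenik2017, Lemma 3.19] -/
theorem isingCorr_eq_sum_isingExpect_plusIndicator (Λ : Finset V) (β h : ℝ)
    (bc : BoundaryCondition V) (A : Finset V) :
    isingCorr G Λ β h bc A = ∑ B ∈ A.powerset,
      ((-1 : ℝ) ^ #(A \ B) * 2 ^ #B) * isingExpect G Λ β h bc (plusIndicator B) := by
  rw [isingCorr, show spinProduct A = fun σ => ∑ B ∈ A.powerset,
        ((-1 : ℝ) ^ #(A \ B) * 2 ^ #B) * plusIndicator B σ from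
      funext fun σ => spinProduct_eq_sum_plusIndicator A σ,
    isingExpect_finset_sum' G Λ h bc β A.powerset
      (fun B σ => ((-1 : ℝ) ^ #(A \ B) * 2 ^ #B) * plusIndicator B σ)
      fun B => (measurable_plusIndicator B).const_mul _]
  exact sum_congr rfl fun B _ => isingExpect_const_mul' G Λ h bc β _ (measurable_plusIndicator B)

/-- **FKG sandwich in the boundary condition, uniform form** (Friedli–Velenik 2017, Lemma 3.23 and
Exercise 3.13, combined with Lemma 3.19): for `β ≥ 0`, any field `h`, any finite `Λ`, `A` and
EVERY boundary condition `η`,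
`|⟨σ_A⟩^η_{Λ;β,h} - ⟨σ_A⟩⁺_{Λ;β,h}| ≤ ∑_{B ⊆ A} 2^{|B|} (⟨n_B⟩⁺_{Λ;β,h} - ⟨n_B⟩⁻_{Λ;β,h})`,
because each increasing indicator satisfies `⟨n_B⟩⁻_Λ ≤ ⟨n_B⟩^η_Λ ≤ ⟨n_B⟩⁺_Λ`; the right side
does not depend on `η`. [cite: FriedliVelenik2017, Lemma 3.23 and Exercise 3.13] -/
theorem abs_isingCorr_fixed_sub_plus_le_sum {β : ℝ} (hβ : 0 ≤ β) (Λ : Finset V) (h : ℝ)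
    (η : SpinConfig V) (A : Finset V) :
    |isingCorr G Λ β h (.fixed η) A - isingCorr G Λ β h .plus A| ≤
      ∑ B ∈ A.powerset, |(-1 : ℝ) ^ #(A \ B) * 2 ^ #B| *
        (isingExpect G Λ β h .plus (plusIndicator B) -
          isingExpect G Λ β h .minus (plusIndicator B)) := by
  rw [isingCorr_eq_sum_isingExpect_plusIndicator G Λ β h (.fixed η) A,
    isingCorr_eq_sum_isingExpect_plusIndicator G Λ β h .plus A, ← Finset.sum_sub_distrib]
  refine (Finset.abs_sum_le_sum_abs _ _).trans (Finset.sum_le_sum fun B _ => ?_)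
  rw [← mul_sub, abs_mul]
  refine mul_le_mul_of_nonneg_left ?_ (abs_nonneg _)
  have h1 : isingExpect G Λ β h (.fixed η) (plusIndicator B) ≤
      isingExpect G Λ β h .plus (plusIndicator B) :=
    isingExpect_fixed_le_plus G hβ Λ h η (plusIndicator_mono B) (measurable_plusIndicator B)
  have h2 : isingExpect G Λ β h .minus (plusIndicator B) ≤
      isingExpect G Λ β h (.fixed η) (plusIndicator B) :=
    isingExpect_minus_le_fixed G hβ Λ h η (plusIndicator_mono B) (measurable_plusIndicator B)
  rw [abs_sub_comm, abs_of_nonneg (sub_nonneg.2 h1)]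
  linarith

end Sandwich

/-! ### Uniform convergence on `ℤ^d` when `m*(β) = 0` -/

/-- **The increasing indicators have boundary-condition-independent limits when `m*(β) = 0`**
(Friedli–Velenik 2017, Thm. 3.28 with Remark 3.30, via Lemma 3.19): for `β ≥ 0` with
`m*(β) = 0` and `bc ∈ {free, +, -}`,
`⟨n_B⟩^{bc}_{B(L);β,0} → 2^{-|B|} ∑_{D ⊆ B} ⟨σ_D⟩⁺_{β,0}` as `L → ∞`.
[cite: FriedliVelenik2017, Thm. 3.28 and Remark 3.30] -/
theorem tendsto_isingExpect_plusIndicator_box_of_spontaneousMagnetization_eq_zero {d : ℕ} {β : ℝ}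
    (hβ : 0 ≤ β) (hm : spontaneousMagnetization d β = 0) (B : Finset (Site d)) :
    ∀ bc ∈ ({.free, .plus, .minus} : Set (BoundaryCondition (Site d))),
      Tendsto (fun L : ℕ => isingExpect (zdGraph d) (box d L) β 0 bc (plusIndicator B)) atTop
        (𝓝 (((2 : ℝ) ^ #B)⁻¹ * ∑ D ∈ B.powerset, plusCorr d β 0 D)) := by
  intro bc hbc
  simp_rw [isingExpect_plusIndicator]
  exact (tendsto_finsetSum _ fun D _ =>
    hasBoxLimit_isingCorr_of_spontaneousMagnetization_eq_zero hβ hm D bc hbc).const_mul _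

/-- **The FKG majorant vanishes in the limit when `m*(β) = 0`**: for `β ≥ 0` with `m*(β) = 0`,
`⟨n_B⟩⁺_{B(L);β,0} - ⟨n_B⟩⁻_{B(L);β,0} → 0` (both have the limit `2^{-|B|} ∑_{D⊆B} ⟨σ_D⟩⁺_{β,0}`;
Friedli–Velenik 2017, Thm. 3.28: `m* = 0 ⇒ ⟨·⟩⁺ = ⟨·⟩⁻`).
[cite: FriedliVelenik2017, Thm. 3.28 and Remark 3.30] -/
theorem tendsto_isingExpect_plusIndicator_plus_sub_minus {d : ℕ} {β : ℝ} (hβ : 0 ≤ β)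
    (hm : spontaneousMagnetization d β = 0) (B : Finset (Site d)) :
    Tendsto (fun L : ℕ => isingExpect (zdGraph d) (box d L) β 0 .plus (plusIndicator B) -
      isingExpect (zdGraph d) (box d L) β 0 .minus (plusIndicator B)) atTop (𝓝 0) := by
  have h1 := tendsto_isingExpect_plusIndicator_box_of_spontaneousMagnetization_eq_zero hβ hm B
    .plus (by simp)
  have h2 := tendsto_isingExpect_plusIndicator_box_of_spontaneousMagnetization_eq_zero hβ hm B
    .minus (by simp)
  have h := h1.sub h2
  rwa [sub_self] at h

/-- **Uniform-in-boundary-condition convergence of the box correlations when `m*(β) = 0`**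
(Friedli–Velenik 2017, Lemma 3.23 / Exercise 3.13 and Thm. 3.28 with Remark 3.30; Georgii 2011,
Prop. 7.11: uniqueness ⇔ uniform convergence of `γ_Λ(A | η)`; cf. Friedli–Velenik Lemma 6.30): for
`β ≥ 0` with `m*(β) = 0` and every finite `A ⊂ ℤ^d`, for every `ε > 0` there is `L₀` such that
`|⟨σ_A⟩^η_{B(L);β,0} - ⟨σ_A⟩⁺_{β,0}| ≤ ε` for all `L ≥ L₀` and ALL boundary conditions `η`. Proof:
the FKG sandwich `abs_isingCorr_fixed_sub_plus_le_sum` gives an `η`-free majorant of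
`|⟨σ_A⟩^η_{B(L)} - ⟨σ_A⟩⁺_{B(L)}|` tending to `0`
(`tendsto_isingExpect_plusIndicator_plus_sub_minus`), and `⟨σ_A⟩⁺_{B(L)} → ⟨σ_A⟩⁺` (Thm. 3.17).
[cite: FriedliVelenik2017, Lemma 3.23 and Thm. 3.28] -/
theorem isingCorr_fixed_box_sub_plusCorr_uniform {d : ℕ} {β : ℝ} (hβ : 0 ≤ β)
    (hm : spontaneousMagnetization d β = 0) (A : Finset (Site d)) :
    ∀ ε : ℝ, 0 < ε → ∃ L₀ : ℕ, ∀ L : ℕ, L₀ ≤ L → ∀ η : SpinConfig (Site d),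
      |isingCorr (zdGraph d) (box d L) β 0 (.fixed η) A - plusCorr d β 0 A| ≤ ε := by
  intro ε hε
  -- the `η`-free majorant of `|⟨σ_A⟩^η_{B(L)} - ⟨σ_A⟩⁺_{B(L)}|` tends to `0`
  have hgap : Tendsto (fun L : ℕ => ∑ B ∈ A.powerset, |(-1 : ℝ) ^ #(A \ B) * 2 ^ #B| *
      (isingExpect (zdGraph d) (box d L) β 0 .plus (plusIndicator B) -
        isingExpect (zdGraph d) (box d L) β 0 .minus (plusIndicator B))) atTop (𝓝 0) := by
    have h := tendsto_finsetSum A.powerset fun B _ =>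
      (tendsto_isingExpect_plusIndicator_plus_sub_minus hβ hm B).const_mul
        |(-1 : ℝ) ^ #(A \ B) * 2 ^ #B|
    simp only [mul_zero, Finset.sum_const_zero] at h
    exact h
  -- `⟨σ_A⟩⁺_{B(L)} → ⟨σ_A⟩⁺`
  have hplus : Tendsto (fun L : ℕ =>
      |isingCorr (zdGraph d) (box d L) β 0 .plus A - plusCorr d β 0 A|) atTop (𝓝 0) := by
    have h := ((tendsto_isingCorr_plus_box (d := d) hβ 0 A).sub_const (plusCorr d β 0 A)).abs
    rwa [sub_self, abs_zero] at h
  have htot := hgap.add hplus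
  rw [add_zero] at htot
  obtain ⟨L₀, hL₀⟩ := Metric.tendsto_atTop.1 htot ε hε
  refine ⟨L₀, fun L hL η => ?_⟩
  have hdist := hL₀ L hL
  rw [Real.dist_eq, sub_zero] at hdist
  calc |isingCorr (zdGraph d) (box d L) β 0 (.fixed η) A - plusCorr d β 0 A|
      ≤ |isingCorr (zdGraph d) (box d L) β 0 (.fixed η) A -
            isingCorr (zdGraph d) (box d L) β 0 .plus A| +
          |isingCorr (zdGraph d) (box d L) β 0 .plus A - plusCorr d β 0 A| := abs_sub_le _ _ _
    _ ≤ (∑ B ∈ A.powerset, |(-1 : ℝ) ^ #(A \ B) * 2 ^ #B| *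
          (isingExpect (zdGraph d) (box d L) β 0 .plus (plusIndicator B) -
            isingExpect (zdGraph d) (box d L) β 0 .minus (plusIndicator B))) +
          |isingCorr (zdGraph d) (box d L) β 0 .plus A - plusCorr d β 0 A| := by
        gcongr
        exact abs_isingCorr_fixed_sub_plus_le_sum (zdGraph d) hβ (box d L) 0 η A
    _ ≤ _ := le_abs_self _
    _ ≤ ε := hdist.le

/-- **Uniform convergence of the boundary-law mixtures when `m*(β) = 0`** (Friedli–Velenik 2017,
Lemma 3.23 and Thm. 3.28 with Remark 3.30, integrated over the boundary law as in §6.2,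
eq. (6.12); Georgii 2011, Prop. 7.11): for `β ≥ 0` with `m*(β) = 0` and finite `A`, for every
`ε > 0` there is `L₀` such that `|boundaryLawFunctional d L β ν A - ⟨σ_A⟩⁺_{β,0}| ≤ ε` for all
`L ≥ L₀` and ALL probability boundary laws `ν`:
`|∫ (⟨σ_A⟩^η_{B(L)} - ⟨σ_A⟩⁺) ν(dη)| ≤ ∫ ε dν = ε` by `isingCorr_fixed_box_sub_plusCorr_uniform`.
[cite: FriedliVelenik2017, Lemma 3.23 and Thm. 3.28] -/
theorem boundaryLawFunctional_sub_plusCorr_uniform {d : ℕ} {β : ℝ} (hβ : 0 ≤ β)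
    (hm : spontaneousMagnetization d β = 0) (A : Finset (Site d)) :
    ∀ ε : ℝ, 0 < ε → ∃ L₀ : ℕ, ∀ L : ℕ, L₀ ≤ L →
      ∀ (ν : Measure (SpinConfig (Site d))) [IsProbabilityMeasure ν],
        |boundaryLawFunctional d L β ν A - plusCorr d β 0 A| ≤ ε := by
  intro ε hε
  obtain ⟨L₀, hL₀⟩ := isingCorr_fixed_box_sub_plusCorr_uniform hβ hm A ε hε
  refine ⟨L₀, fun L hL ν _ => ?_⟩
  have hint : Integrable (fun η : SpinConfig (Site d) =>
      isingCorr (zdGraph d) (box d L) β 0 (.fixed η) A) ν :=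
    Integrable.of_bound (measurable_isingCorr_fixed_box L β A).aestronglyMeasurable 1
      (Eventually.of_forall fun η => by
        rw [Real.norm_eq_abs]; exact abs_isingCorr_le_one (zdGraph d) (box d L) β 0 _ A)
  have hsub : boundaryLawFunctional d L β ν A - plusCorr d β 0 A =
      ∫ η, (isingCorr (zdGraph d) (box d L) β 0 (.fixed η) A - plusCorr d β 0 A) ∂ν := by
    rw [integral_sub hint (integrable_const _), integral_const, boundaryLawFunctional_apply]
    simp
  rw [hsub]
  have h := norm_integral_le_of_norm_le_const (μ := ν) (C := ε)
    (f := fun η : SpinConfig (Site d) =>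
      isingCorr (zdGraph d) (box d L) β 0 (.fixed η) A - plusCorr d β 0 A)
    (Eventually.of_forall fun η => by rw [Real.norm_eq_abs]; exact hL₀ L hL η)
  simpa [Real.norm_eq_abs] using h

/-! ### The critical case on `ℤ³` -/

/-- **Uniform convergence of the critical boundary-law mixtures on pairs, `d = 3`**: for `x ≠ 0`
and every `ε > 0` there is `L₀` such that for all `L ≥ L₀` and ALL probability boundary laws `ν`
on `{±1}^{ℤ³}`, `|boundaryLawFunctional 3 L β_c(3) ν {0, x} - ⟨σ₀σ_x⟩⁺_{β_c(3),0}| ≤ ε`. The input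
`m*(β_c) = 0` for `d = 3` is Aizenman–Duminil-Copin–Sidoravicius 2015, Thm. 1.2 (tree theorem
`spontaneousMagnetization_criticalBeta_eq_zero_holds`); then
`boundaryLawFunctional_sub_plusCorr_uniform` applies at `β = β_c(3) ≥ 0`, and
`⟨σ_{{0,x}}⟩⁺_{β_c,0} = criticalTwoPoint 3 x` (`twoPointPlus_eq_plusCorr_pair`).
[cite: FriedliVelenik2017, Lemma 3.23 and Thm. 3.28]
[cite: AizenmanDuminilCopinSidoraviciusCMP2015, Thm. 1.2] -/
theorem boundaryLawFunctional_criticalBeta_pair_sub_criticalTwoPoint_uniform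
    {x : Site 3} (hx : x ≠ 0) :
    ∀ ε : ℝ, 0 < ε → ∃ L₀ : ℕ, ∀ L : ℕ, L₀ ≤ L →
      ∀ (ν : Measure (SpinConfig (Site 3))) [IsProbabilityMeasure ν],
        |boundaryLawFunctional 3 L (criticalBeta 3) ν {0, x} - criticalTwoPoint 3 x| ≤ ε := by
  rw [criticalTwoPoint, twoPointPlus_eq_plusCorr_pair _ hx]
  exact boundaryLawFunctional_sub_plusCorr_uniform (criticalBeta_nonneg 3)
    (spontaneousMagnetization_criticalBeta_eq_zero_holds (d := 3) le_rfl) {0, x}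

end Literature.Probability.LatticeModels

end
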